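import Literature.AnabelianGeometry.EtaleTheta.FrobenioidTheta
import Literature.AlgebraicGeometry.Frobenioids.MonoidTransport
import Mathlib.GroupTheory.MonoidLocalization.GrothendieckGroup

/-!
# [EtTh] §5: Proposition 5.3 (Category-theoreticity of the Geometry of Divisors) (pp. 324–327 / PDF pp. 98–101)

Mochizuki, *The étale theta function …*, Publ. RIMS **45** (2009)
[cite: MochizukiEtTh2009, Prop 5.3 p.325 (PDF p.99)].  Seat abc-iut-L2-t4.  Over the §5 data
`ThetaFrobenioid` (`FrobenioidTheta.lean`): **Proposition 5.3** (i)–(vi) — for the self-equivalence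
`Ψ : C ⥲ C` and "an isomorphism `Ψ(A_⊚) ⥲ A_⊚` of `C` [cf. Proposition 5.1; Theorem 4.4, (i)]", the
automorphism `Ψ^Φ_{A_⊚}` of the divisor monoid `Φ(A_⊚)` "obtained by composing the isomorphism of divisor
monoids induced by `Ψ` [cf. Corollary 3.8, (iii); [FrdI], Theorem 4.9] with the isomorphism
`Φ(Ψ(A_⊚)) ⥲ Φ(A_⊚)` induced by the chosen isomorphism" (p.325 (PDF p.99)) preserves the
cuspidal/non-cuspidal structure, the natural isomorphisms between primary components, the surjection
`Prime^csp ↠ Prime^ncsp`, the labels `Prime^ncsp ⥲ ℤ` up to `±`/translation, and the `Aut_C(A_⊚)`-orbit of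
`div(Θ̈) ∈ Φ(A_⊚)^gp`.
REAL here: `Φ(A_⊚) = 𝔉.pre.Mon (A_⊚^bs)` (the tree's `PreFrobenioidData`); the action of `Aut_C(A_⊚)` on
`Φ(A_⊚)` by pull-back (`pullAut`) and on `Φ(A_⊚)^gp` (`gpMap`); the transport `Φ(Ψ(A_⊚)) ⥲ Φ(A_⊚)` along
`ι` (`pullIso`); `Ψ^Φ_{A_⊚}` itself (`psiPhi`) from the `Ψ`-induced isomorphism of divisor monoids, which
is abc-iut-L2-t3 / abc-iut-L1-t3 vocabulary (Cor. 3.8 (iii) / [FrdI] Thm. 4.9) and enters through the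
stub `DivisorTransportStub`; primes and their transport are the tree's `Frobenioids.Primes`,
`Primes.congr`, `Primes.submonoidCongr` (`MonoidTransport.lean`).  The cuspidal/non-cuspidal structure,
the component isomorphisms, the surjection, the labels and `div(Θ̈)` are abc-iut-L2-t3 / found data
(stub `DivisorPrimeData`, `TODO-merge`).  The printed proof ("the well-known intersection theory of
divisors supported on the chain of copies of the projective line", pp.326–327 (PDF pp.100–101)) is not
formalised.  (ii)–(v) are stated under a proof `hc` that `Ψ^Φ_{A_⊚}` preserves cuspidality of primes
(their printed prerequisite, part of (i)), so that no clause is vacuous.  HONEST FRAMING: typed ≠ proved.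
-/

namespace Literature.AnabelianGeometry.EtaleTheta

open CategoryTheory
open Literature.AlgebraicGeometry.Frobenioids (Primes IsPrimary)

universe w v v' u u'

namespace ThetaFrobenioid

variable {C : Type u} [Category.{v} C] {D : Type u'} [Category.{v'} D] (𝔉 : ThetaFrobenioid.{w} C D)

/-! ### `Φ(A_⊚)` and the actions on it -/

/-- `Φ(A_⊚)`, the divisor monoid of `A_⊚` (the tree's `PreFrobenioidData.Mon` at `A_⊚^bs`; p.325 (PDF p.99)).
[cite: MochizukiEtTh2009, Prop 5.3 p.325 (PDF p.99)] -/
abbrev PhiAcirc : Type w := 𝔉.pre.Mon (𝔉.base.obj 𝔉.Acirc)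

/-- `Φ(T) ⥲ Φ(S)` along an isomorphism `ι : S ≅ T` of `C`: pull-back along `ι^bs` (inverse: along
`(ι⁻¹)^bs`) — "the isomorphism `Φ(Ψ(A_⊚)) ⥲ Φ(A_⊚)` induced by the chosen isomorphism `Ψ(A_⊚) ⥲ A_⊚`"
(p.325 (PDF p.99)).  [cite: MochizukiEtTh2009, Prop 5.3 p.325 (PDF p.99)] -/
def pullIso {S T : C} (ι : S ≅ T) : 𝔉.pre.Mon (𝔉.base.obj T) ≃* 𝔉.pre.Mon (𝔉.base.obj S) where
  toFun := 𝔉.pre.pull (𝔉.base.map ι.hom)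
  invFun := 𝔉.pre.pull (𝔉.base.map ι.inv)
  left_inv x := by
    rw [← 𝔉.pre.pull_comp, ← Functor.map_comp, ι.inv_hom_id, CategoryTheory.Functor.map_id, 𝔉.pre.pull_id]
  right_inv x := by
    rw [← 𝔉.pre.pull_comp, ← Functor.map_comp, ι.hom_inv_id, CategoryTheory.Functor.map_id, 𝔉.pre.pull_id]
  map_mul' := map_mul _

/-- The action of `g ∈ Aut_C(A)` on `Φ(A)` (through `Aut_D(A^bs)` and the contravariant functoriality of
`Φ`): pull-back along `(g⁻¹)^bs` (used for "the `Aut_C(A_⊚)`-orbit", Prop. 5.3 (vi), p.326 (PDF p.100)).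
[cite: MochizukiEtTh2009, Prop 5.3 (vi) p.326 (PDF p.100)] -/
def pullAut {S : C} (g : Aut S) : 𝔉.pre.Mon (𝔉.base.obj S) ≃* 𝔉.pre.Mon (𝔉.base.obj S) :=
  𝔉.pullIso g.symm

/-- The induced endomorphism of `Φ^gp` of a monoid endomorphism of `Φ` (universal property of the
Grothendieck group; used for `(Ψ^Φ_{A_⊚})^gp` and the `Aut_C(A_⊚)`-action on `Φ(A_⊚)^gp`, p.326 (PDF p.100)).
[cite: MochizukiEtTh2009, Prop 5.3 (vi) p.326 (PDF p.100)] -/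
noncomputable def gpMap {M : Type w} [CommMonoid M] (e : M →* M) :
    Algebra.GrothendieckGroup M →* Algebra.GrothendieckGroup M :=
  Algebra.GrothendieckGroup.lift (Algebra.GrothendieckGroup.of.comp e)

/-- `gpMap e` extends `e`: `gpMap e (of a) = of (e a)`. [cite: MochizukiEtTh2009, Prop 5.3 (vi) p.326 (PDF p.100)] -/
theorem gpMap_of {M : Type w} [CommMonoid M] (e : M →* M) (a : M) :
    gpMap e (Algebra.GrothendieckGroup.of a) = Algebra.GrothendieckGroup.of (e a) := by
  have h := Algebra.GrothendieckGroup.lift.symm_apply_apply (Algebra.GrothendieckGroup.of.comp e)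
  rw [Algebra.GrothendieckGroup.lift_symm_apply] at h
  exact DFunLike.congr_fun h a

end ThetaFrobenioid

namespace FrobenioidThetaDivisors

variable {C : Type u} [Category.{v} C] {D : Type u'} [Category.{v'} D] (𝔉 : ThetaFrobenioid.{w} C D)

/-- **LOCAL STUB — `TODO-merge(abc-iut-L2-t3, abc-iut-L1-t3)`.**  "The isomorphism of divisor monoids
induced by `Ψ : C ⥲ C` [cf. Corollary 3.8, (iii); [FrdI], Theorem 4.9]" (p.325 (PDF p.99)): for a
self-equivalence `Ψ` and an object `A`, WHICH isomorphisms `Φ(A) ⥲ Φ(Ψ(A))` are the one induced by `Ψ`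
(the category-theoretic reconstruction of the divisor monoid).  Owner decls: abc-iut-L1-t3's [FrdI]
Thm. 4.9 / abc-iut-L2-t3's Cor. 3.8 (iii).  [cite: MochizukiEtTh2009, Prop 5.3 p.325 (PDF p.99)] -/
structure DivisorTransportStub where
  /-- `e : Φ(A) ⥲ Φ(Ψ(A))` is the isomorphism of divisor monoids induced by `Ψ` ([FrdI] Thm. 4.9). -/
  IsInducedBy : ∀ (Ψ : C ≌ C) (A : C),
    (𝔉.pre.Mon (𝔉.base.obj A) ≃* 𝔉.pre.Mon (𝔉.base.obj (Ψ.functor.obj A))) → Prop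

/-- **`Ψ^Φ_{A_⊚} : Φ(A_⊚) ⥲ Φ(A_⊚)`**, "the automorphism of the monoid `Φ(A_⊚)` obtained by composing the
isomorphism of divisor monoids induced by `Ψ` … with the isomorphism `Φ(Ψ(A_⊚)) ⥲ Φ(A_⊚)` induced by the
chosen isomorphism `Ψ(A_⊚) ⥲ A_⊚`" (p.325 (PDF p.99)), for a `Ψ`-induced `e` and `ι : Ψ(A_⊚) ≅ A_⊚`.
[cite: MochizukiEtTh2009, Prop 5.3 p.325 (PDF p.99)] -/
def psiPhi (Ψ : C ≌ C) (ι : Ψ.functor.obj 𝔉.Acirc ≅ 𝔉.Acirc)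
    (e : 𝔉.PhiAcirc ≃* 𝔉.pre.Mon (𝔉.base.obj (Ψ.functor.obj 𝔉.Acirc))) : 𝔉.PhiAcirc ≃* 𝔉.PhiAcirc :=
  e.trans (𝔉.pullIso ι).symm

/-- **LOCAL STUB — `TODO-merge(abc-iut-found, abc-iut-L2-t3)`.**  The divisor geometry of `A_⊚` used by
Proposition 5.3 (pp.324–326 (PDF pp.98–100)) beyond the monoid `Φ(A_⊚)` itself: cuspidal / non-cuspidal
elements and primes ([EtTh] §3; "the special fiber of '`Ÿ`' … an infinite chain of copies of the
projective line, joined to one another at the points '`0`' and '`∞`'", pp.324–325), the "natural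
isomorphism between 'primary components' `Φ(A_⊚)_𝔭 ⥲ Φ(A_⊚)_𝔮`" for non-cuspidal (Rmk. 3.8.2) and for
cuspidal primes (p.325), the "natural surjection `Prime(Φ(A_⊚))^csp ↠ Prime(Φ(A_⊚))^ncsp`" (p.325), the
"natural bijection `Prime(Φ(A_⊚))^ncsp ⥲ ℤ` … well-defined up to … translation … and multiplication by
`±1`" (p.325; a chosen representative), and "the divisor of zeroes and poles `∈ Φ(A_⊚)^gp` of … the theta
function `Θ̈`" (p.326).  [cite: MochizukiEtTh2009, Prop 5.3 p.325 (PDF p.99)] -/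
structure DivisorPrimeData where
  /-- cuspidal elements of `Φ(A_⊚)` ([EtTh] §3; Prop. 5.3 (i)). -/
  IsCuspidalElt : 𝔉.PhiAcirc → Prop
  /-- non-cuspidal elements of `Φ(A_⊚)` (Prop. 5.3 (i)). -/
  IsNonCuspidalElt : 𝔉.PhiAcirc → Prop
  /-- cuspidal primes `Prime(Φ(A_⊚))^csp` (the non-cuspidal primes `Prime(Φ(A_⊚))^ncsp` are the others). -/
  IsCuspidal : Primes 𝔉.PhiAcirc → Prop
  /-- a prime is cuspidal iff its primary elements are cuspidal ([EtTh] §3; links the two predicates). -/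
  isCuspidal_iff : ∀ p : Primes 𝔉.PhiAcirc, IsCuspidal p ↔ ∀ a ∈ p.carrier, IsCuspidalElt a
  /-- "the natural isomorphisms between distinct non-cuspidal primary components of `Φ(A_⊚)`
  [cf. Remark 3.8.2]" (Prop. 5.3 (ii)). -/
  ncspIso : ∀ p q : Primes 𝔉.PhiAcirc, ¬ IsCuspidal p → ¬ IsCuspidal q → (p.submonoid ≃* q.submonoid)
  /-- "the natural isomorphisms … between distinct cuspidal primary components of `Φ(A_⊚)`" (p.325;
  Prop. 5.3 (iii)). -/
  cspIso : ∀ p q : Primes 𝔉.PhiAcirc, IsCuspidal p → IsCuspidal q → (p.submonoid ≃* q.submonoid)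
  /-- "the natural surjection `Prime(Φ(A_⊚))^csp ↠ Prime(Φ(A_⊚))^ncsp`" ("given by considering the
  irreducible component of the special fiber that contains the cusp(s)", p.325; Prop. 5.3 (iv)). -/
  cspToNcsp : {p : Primes 𝔉.PhiAcirc // IsCuspidal p} → {p : Primes 𝔉.PhiAcirc // ¬ IsCuspidal p}
  /-- it is surjective (p.325). -/
  cspToNcsp_surjective : Function.Surjective cspToNcsp
  /-- "the natural bijection `Prime(Φ(A_⊚))^ncsp ⥲ ℤ`" (p.325; a representative of a datum well-defined
  up to translation and `±1`; Prop. 5.3 (v)). -/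
  ncspEquivZ : {p : Primes 𝔉.PhiAcirc // ¬ IsCuspidal p} ≃ ℤ
  /-- "the divisor of zeroes and poles `∈ Φ(A_⊚)^gp` of [the Frobenioid-theoretic version of …] the theta
  function `Θ̈` of Proposition 1.4" (Prop. 5.3 (vi), p.326). -/
  divTheta : Algebra.GrothendieckGroup 𝔉.PhiAcirc

variable {𝔉} (T : DivisorTransportStub 𝔉) (𝔓 : DivisorPrimeData 𝔉) (Ψ : C ≌ C)
  (ι : Ψ.functor.obj 𝔉.Acirc ≅ 𝔉.Acirc) (e : 𝔉.PhiAcirc ≃* 𝔉.pre.Mon (𝔉.base.obj (Ψ.functor.obj 𝔉.Acirc)))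

/-! In the six statements, `Ψ : C ⥲ C` is the self-equivalence, `ι : Ψ(A_⊚) ⥲ A_⊚` the chosen
isomorphism [Prop. 5.1; Thm. 4.4 (i)], `e` the `Ψ`-induced isomorphism of divisor monoids (hypothesis
`T.IsInducedBy Ψ A_⊚ e`), and `Ψ^Φ_{A_⊚} = psiPhi Ψ ι e`. -/

/-- **[EtTh] Proposition 5.3 (i)** (p.325 (PDF p.99)): `Ψ^Φ_{A_⊚}` preserves "non-cuspidal and cuspidal
elements" — and hence (used by (ii)–(v)) cuspidal and non-cuspidal primes.
[cite: MochizukiEtTh2009, Prop 5.3 (i) p.325 (PDF p.99)] -/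
def PreservesCuspidality : Prop :=
  T.IsInducedBy Ψ 𝔉.Acirc e →
    (∀ a, 𝔓.IsNonCuspidalElt a ↔ 𝔓.IsNonCuspidalElt (psiPhi 𝔉 Ψ ι e a)) ∧
    (∀ a, 𝔓.IsCuspidalElt a ↔ 𝔓.IsCuspidalElt (psiPhi 𝔉 Ψ ι e a)) ∧
    (∀ p, 𝔓.IsCuspidal (Primes.congr (psiPhi 𝔉 Ψ ι e) p) ↔ 𝔓.IsCuspidal p)

/-- The prime-level clause of (i), as a hypothesis type for (ii)–(v).
[cite: MochizukiEtTh2009, Prop 5.3 (i) p.325 (PDF p.99)] -/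
abbrev CuspPreserved : Prop := ∀ p, 𝔓.IsCuspidal (Primes.congr (psiPhi 𝔉 Ψ ι e) p) ↔ 𝔓.IsCuspidal p

/-- **[EtTh] Proposition 5.3 (ii)** (p.325 (PDF p.99)): `Ψ^Φ_{A_⊚}` preserves "the natural isomorphisms
between distinct non-cuspidal primary components of `Φ(A_⊚)` [cf. Remark 3.8.2]": for non-cuspidal
`𝔭 ≠ 𝔮`, `Ψ^Φ ∘ ι_{𝔭,𝔮} = ι_{Ψ^Φ𝔭, Ψ^Φ𝔮} ∘ Ψ^Φ` on `Φ(A_⊚)_𝔭` (given (i) on primes, `hc`).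
[cite: MochizukiEtTh2009, Prop 5.3 (ii) p.325 (PDF p.99)] -/
def PreservesNcspComponentIsos (hc : CuspPreserved 𝔓 Ψ ι e) : Prop :=
  ∀ (p q : Primes 𝔉.PhiAcirc) (hp : ¬ 𝔓.IsCuspidal p) (hq : ¬ 𝔓.IsCuspidal q), p ≠ q →
    ∀ x : p.submonoid,
      psiPhi 𝔉 Ψ ι e (𝔓.ncspIso p q hp hq x : 𝔉.PhiAcirc) =
        (𝔓.ncspIso _ _ (fun h => hp ((hc p).mp h)) (fun h => hq ((hc q).mp h))
          (Primes.submonoidCongr (psiPhi 𝔉 Ψ ι e) p _ rfl x) : 𝔉.PhiAcirc)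

/-- **[EtTh] Proposition 5.3 (iii)** (p.325 (PDF p.99)): `Ψ^Φ_{A_⊚}` preserves "the natural isomorphisms
… between distinct cuspidal primary components of `Φ(A_⊚)`".
[cite: MochizukiEtTh2009, Prop 5.3 (iii) p.325 (PDF p.99)] -/
def PreservesCspComponentIsos (hc : CuspPreserved 𝔓 Ψ ι e) : Prop :=
  ∀ (p q : Primes 𝔉.PhiAcirc) (hp : 𝔓.IsCuspidal p) (hq : 𝔓.IsCuspidal q), p ≠ q →
    ∀ x : p.submonoid,
      psiPhi 𝔉 Ψ ι e (𝔓.cspIso p q hp hq x : 𝔉.PhiAcirc) =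
        (𝔓.cspIso _ _ ((hc p).mpr hp) ((hc q).mpr hq)
          (Primes.submonoidCongr (psiPhi 𝔉 Ψ ι e) p _ rfl x) : 𝔉.PhiAcirc)

/-- **[EtTh] Proposition 5.3 (iv)** (p.325 (PDF p.99)): `Ψ^Φ_{A_⊚}` preserves "the natural surjection
`Prime(Φ(A_⊚))^csp ↠ Prime(Φ(A_⊚))^ncsp`".  [cite: MochizukiEtTh2009, Prop 5.3 (iv) p.325 (PDF p.99)] -/
def PreservesCspToNcsp (hc : CuspPreserved 𝔓 Ψ ι e) : Prop :=
  ∀ (p : Primes 𝔉.PhiAcirc) (hp : 𝔓.IsCuspidal p),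
    (𝔓.cspToNcsp ⟨Primes.congr (psiPhi 𝔉 Ψ ι e) p, (hc p).mpr hp⟩ : Primes 𝔉.PhiAcirc) =
      Primes.congr (psiPhi 𝔉 Ψ ι e) (𝔓.cspToNcsp ⟨p, hp⟩ : Primes 𝔉.PhiAcirc)

/-- **[EtTh] Proposition 5.3 (v)** (p.325 (PDF p.99)): `Ψ^Φ_{A_⊚}` preserves "the natural bijection
`Prime(Φ(A_⊚))^ncsp ⥲ ℤ` [up to translation by an element of `ℤ` and multiplication by `±1`]": there are
`ε = ±1` and `c ∈ ℤ` with `label(Ψ^Φ 𝔭) = ε · label(𝔭) + c` for every non-cuspidal `𝔭`.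
[cite: MochizukiEtTh2009, Prop 5.3 (v) p.325 (PDF p.99)] -/
def PreservesNcspLabels (hc : CuspPreserved 𝔓 Ψ ι e) : Prop :=
  ∃ (ε : ℤˣ) (c : ℤ), ∀ (p : Primes 𝔉.PhiAcirc) (hp : ¬ 𝔓.IsCuspidal p),
    𝔓.ncspEquivZ ⟨Primes.congr (psiPhi 𝔉 Ψ ι e) p, fun h => hp ((hc p).mp h)⟩ =
      (ε : ℤ) * 𝔓.ncspEquivZ ⟨p, hp⟩ + c

/-- **[EtTh] Proposition 5.3 (vi)** (p.326 (PDF p.100)): `Ψ^Φ_{A_⊚}` [extended to `Φ(A_⊚)^gp`] preserves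
"the `Aut_C(A_⊚)`-orbit of the divisor of zeroes and poles `∈ Φ(A_⊚)^gp` of … the theta function `Θ̈`".
[cite: MochizukiEtTh2009, Prop 5.3 (vi) p.326 (PDF p.100)] -/
def PreservesThetaDivisorOrbit : Prop :=
  ThetaFrobenioid.gpMap (psiPhi 𝔉 Ψ ι e : 𝔉.PhiAcirc →* 𝔉.PhiAcirc) ''
      (Set.range fun g : Aut 𝔉.Acirc =>
        ThetaFrobenioid.gpMap (𝔉.pullAut g : 𝔉.PhiAcirc →* 𝔉.PhiAcirc) 𝔓.divTheta) =
    Set.range fun g : Aut 𝔉.Acirc =>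
      ThetaFrobenioid.gpMap (𝔉.pullAut g : 𝔉.PhiAcirc →* 𝔉.PhiAcirc) 𝔓.divTheta

/-- **[EtTh] Proposition 5.3** (pp.325–326 (PDF pp.99–100)), all six parts for the self-equivalence `Ψ`,
the chosen `ι : Ψ(A_⊚) ⥲ A_⊚` and the `Ψ`-induced isomorphism of divisor monoids `e`: "`Ψ^Φ_{A_⊚}`
preserves the following objects: (i) … (vi)".  [cite: MochizukiEtTh2009, Prop 5.3 p.325–326 (PDF pp.99–100)] -/
structure GeometryOfDivisorsPreserved : Prop where
  /-- `e` is the `Ψ`-induced isomorphism of divisor monoids ([FrdI] Thm. 4.9) -/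
  induced : T.IsInducedBy Ψ 𝔉.Acirc e
  /-- (i), element level -/
  elements : (∀ a, 𝔓.IsNonCuspidalElt a ↔ 𝔓.IsNonCuspidalElt (psiPhi 𝔉 Ψ ι e a)) ∧
    (∀ a, 𝔓.IsCuspidalElt a ↔ 𝔓.IsCuspidalElt (psiPhi 𝔉 Ψ ι e a))
  /-- (i), prime level -/
  primes : CuspPreserved 𝔓 Ψ ι e
  /-- (ii) -/
  ncspIsos : PreservesNcspComponentIsos 𝔓 Ψ ι e primes
  /-- (iii) -/
  cspIsos : PreservesCspComponentIsos 𝔓 Ψ ι e primes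
  /-- (iv) -/
  cspToNcsp : PreservesCspToNcsp 𝔓 Ψ ι e primes
  /-- (v) -/
  labels : PreservesNcspLabels 𝔓 Ψ ι e primes
  /-- (vi) -/
  thetaOrbit : PreservesThetaDivisorOrbit 𝔓 Ψ ι e

end FrobenioidThetaDivisors

end Literature.AnabelianGeometry.EtaleTheta
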